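import Mathlib

/-!
# Per-position ratio `0.74` of the all-split endgame

Crux `Summit.MatrixMultiplication.MatrixMultiplication.Theses.SnSubsetDichotomy.PolynomialSlack`
(item `stmt-MatrixMultiplication-8306`), level-one programme, line transport-split-hull (lead c9).

In the all-split endgame, at each hub position the masses `X` (T-side) and `Y` (S-side, `Y ≤ X`),
the rider overlap `H`, the productive kept mass `K` and the entropy cost `cost` satisfy
`X + Y ≤ 1 + H` (sub-partitions of unity), `K ≤ X Y - 0.49 H²` (Ferrers/overlap lemma) and
`cost ≥ 0.245 (X + Y) + K / (2 X)` (rate box and productivity threshold).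
`position_ratio_le` is the pure real-polynomial consequence `K ≤ 0.74 · cost`
(numerically the supremum of `K / cost` is `≈ 0.7124`, attained near `X ≈ 1, Y ≈ H ≈ 0.75`).

Proof. For `X = 0` everything vanishes. For `X > 0` the claim is equivalent (clearing the
denominator `2X`) to the key inequality `K (2X - 0.74) ≤ 0.3626 · X (X + Y)`, which is trivial if
`2X ≤ 0.74`, and otherwise follows from `K ≤ X Y - 0.49 H²` and two polynomial inequalities in
`X, Y` alone: if `X + Y ≤ 1` drop `H² ≥ 0` (`poly_small`), and if `X + Y ≥ 1` use
`H ≥ X + Y - 1 ≥ 0` (`poly_large`). Both polynomial inequalities are closed by `linarith` from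
explicit Positivstellensatz certificates (products of the constraints and a few squares).
-/

namespace Summit.MatrixMultiplication.MatrixMultiplication.Theorems.PolynomialSlack

set_option linter.dupNamespace false

/-- Case `X + Y ≤ 1` of the key inequality, after dividing by `X`:
`Y (2X - 0.74) ≤ 0.3626 (X + Y)` for `0 ≤ Y ≤ X`, `X + Y ≤ 1`.
Certificate: `0.3626 (X+Y) - Y (2X - 0.74)
  = 0.0952 (X-Y) + 0.9304 Y² + 1.4652 Y (1-X-Y) + 0.2674 (X-Y)² + 0.2674 (X-Y)(1-X-Y)`. -/
theorem poly_small (X Y : ℝ) (hY : 0 ≤ Y) (hXY : Y ≤ X) (hs : X + Y ≤ 1) :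
    Y * (2 * X - 74 / 100) ≤ 3626 / 10000 * (X + Y) := by
  have h1 : 0 ≤ X - Y := sub_nonneg.2 hXY
  have h2 : 0 ≤ 1 - X - Y := by linarith
  linarith [mul_nonneg hY hY, mul_nonneg hY h2, mul_nonneg h1 h1, mul_nonneg h1 h2]

/-- Case `X + Y ≥ 1` of the key inequality, with `H` replaced by its lower bound `X + Y - 1`:
`(X Y - 0.49 (X+Y-1)²) (2X - 0.74) ≤ 0.3626 X (X + Y)` for `0 ≤ Y ≤ X`, `1 ≤ X + Y`
(numerically the slack is `≥ 0.036`; the maximum of the left minus the right side is attained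
near `(X, Y) ≈ (0.98, 0.72)`). Certificate: a nonnegative combination of
`X-Y, (X-Y)², Y²(X-Y), (X-Y)³, (X+Y-1)³, (X-1.1)², (Y-0.7)², (X+Y-1.7)², (X-1.1)²(X+Y-1),
(Y-0.72)² Y`. -/
theorem poly_large (X Y : ℝ) (hY : 0 ≤ Y) (hXY : Y ≤ X) (hs : 1 ≤ X + Y) :
    (X * Y - 49 / 100 * (X + Y - 1) ^ 2) * (2 * X - 74 / 100) ≤ 3626 / 10000 * X * (X + Y) := by
  have h1 : 0 ≤ X - Y := sub_nonneg.2 hXY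
  have h2 : 0 ≤ X + Y - 1 := by linarith
  linarith [mul_nonneg h1 h1, mul_nonneg (mul_nonneg hY hY) h1, mul_nonneg (mul_nonneg h1 h1) h1,
    mul_nonneg (mul_nonneg h2 h2) h2, sq_nonneg (X - 11 / 10), sq_nonneg (Y - 7 / 10),
    sq_nonneg (X + Y - 17 / 10), mul_nonneg (sq_nonneg (X - 11 / 10)) h2,
    mul_nonneg (sq_nonneg (Y - 18 / 25)) hY]

/-- **Per-position ratio `0.74`.** For reals `0 ≤ Y ≤ X`, `0 ≤ H`, `0 ≤ K` with
`X + Y ≤ 1 + H`, `K ≤ X Y - 0.49 H²` and `0.245 (X + Y) + K / (2X) ≤ cost`, one has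
`K ≤ 0.74 · cost`. (For `X = 0` the term `K / (2X)` is `0` by Lean's convention, and then
`K = 0 ≤ 0 ≤ 0.74 · cost`.) The heart is the key inequality `K (2X - 0.74) ≤ 0.3626 X (X+Y)`,
obtained from `poly_small` / `poly_large`. -/
theorem position_ratio_le (X Y H K cost : ℝ) (hY : 0 ≤ Y) (hXY : Y ≤ X) (hH : 0 ≤ H)
    (hK0 : 0 ≤ K) (hsum : X + Y ≤ 1 + H) (hK : K ≤ X * Y - 49 / 100 * H ^ 2)
    (hcost : 49 / 200 * (X + Y) + 1 / 2 * K / X ≤ cost) : K ≤ 74 / 100 * cost := by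
  have hX : 0 ≤ X := hY.trans hXY
  -- the key polynomial inequality
  have key : K * (2 * X - 74 / 100) ≤ 3626 / 10000 * X * (X + Y) := by
    rcases le_or_gt (2 * X) (74 / 100) with hle | hlt
    · nlinarith [mul_nonneg hK0 (sub_nonneg.2 hle), mul_nonneg hX (add_nonneg hX hY)]
    · have h2 : 0 ≤ 2 * X - 74 / 100 := by linarith
      have hKH : K * (2 * X - 74 / 100) ≤ (X * Y - 49 / 100 * H ^ 2) * (2 * X - 74 / 100) :=
        mul_le_mul_of_nonneg_right hK h2
      rcases le_or_gt (X + Y) 1 with hs | hs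
      · -- drop `H² ≥ 0` and use `poly_small`
        have hp : X * (Y * (2 * X - 74 / 100)) ≤ X * (3626 / 10000 * (X + Y)) :=
          mul_le_mul_of_nonneg_left (poly_small X Y hY hXY hs) hX
        have hdrop : (X * Y - 49 / 100 * H ^ 2) * (2 * X - 74 / 100)
            ≤ X * (Y * (2 * X - 74 / 100)) := by
          linarith [mul_nonneg (sq_nonneg H) h2]
        linarith
      · -- use `H ≥ X + Y - 1 ≥ 0` and `poly_large`
        have hH0 : 0 ≤ X + Y - 1 := by linarith
        have hH1 : X + Y - 1 ≤ H := by linarith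
        have hsq : (X + Y - 1) ^ 2 ≤ H ^ 2 := by nlinarith [mul_le_mul hH1 hH1 hH0 hH]
        have hmono : (X * Y - 49 / 100 * H ^ 2) * (2 * X - 74 / 100)
            ≤ (X * Y - 49 / 100 * (X + Y - 1) ^ 2) * (2 * X - 74 / 100) :=
          mul_le_mul_of_nonneg_right (by linarith) h2
        linarith [poly_large X Y hY hXY hs.le]
  rcases hX.eq_or_lt with h0 | hXpos
  · -- degenerate case `X = 0`: then `Y = 0`, `K = 0`, `cost ≥ 0`
    have hx0 : X = 0 := h0.symm
    have hY0 : Y = 0 := le_antisymm (hx0 ▸ hXY) hY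
    have hdiv : 1 / 2 * K / X = 0 := by rw [hx0, div_zero]
    have hKle : K ≤ 0 := by
      rw [hx0] at hK
      nlinarith [sq_nonneg H]
    have hc : 0 ≤ cost := by linarith
    linarith
  · -- main case `X > 0`: clear the denominator in `hcost` using `key`
    have hXne : X ≠ 0 := hXpos.ne'
    have h3 : K / X * X = K := by field_simp
    have h4 : K * X ≤ (1813 / 10000 * (X + Y) + 37 / 100 * (K / X)) * X := by
      have h5 : (1813 / 10000 * (X + Y) + 37 / 100 * (K / X)) * X
          = 1813 / 10000 * X * (X + Y) + 37 / 100 * K := by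
        rw [add_mul, mul_assoc (37 / 100) (K / X) X, h3]; ring
      rw [h5]
      linarith
    have h6 : K ≤ 1813 / 10000 * (X + Y) + 37 / 100 * (K / X) := le_of_mul_le_mul_right h4 hXpos
    calc K ≤ 1813 / 10000 * (X + Y) + 37 / 100 * (K / X) := h6
      _ = 74 / 100 * (49 / 200 * (X + Y) + 1 / 2 * K / X) := by ring
      _ ≤ 74 / 100 * cost := by linarith

end Summit.MatrixMultiplication.MatrixMultiplication.Theorems.PolynomialSlack
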